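import Mathlib
import Literature.Probability.LatticeModels.GKSInequalities
import HarnessLib

/-!
# Crux `PrecisionLaplacian.InverseMFerromagnet` (stmt-CriticalPhenomena-4798), line `Sketch` —
# stub `stub_row_deg_le_two` (C3, rows of `Σ⁻¹` at sites of degree ≤ 2)

THEOREM-ONLY file (no definitions).  Let `Σ = (⟨σ_pσ_q⟩)_{p,q}` be the spin second-moment matrix
of the zero-field pair ferromagnet `gksExpect univ K C` (`K ≥ 0`, `|C i| = 2`) on `Fin n`.  If the
site `z` lies in at most two bonds then every off-diagonal entry of row `z` of `Σ⁻¹` is `≤ 0`.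

Proof ("integrate out `σ_z`").  Let `I = {i : z ∈ C i}` (`|I| ≤ 2`), `C i = {z, u_i}` for
`i ∈ I`, and `h_z = ∑_{i∈I} K_i σ_{u_i}`.  Pairing each configuration with its flip at `z` gives,
for every observable `F` invariant under that flip, `⟨σ_z F⟩ = ⟨tanh(h_z) F⟩`
(`c3_gksExpect_spin_eq_tanh`).  Since `h_z` involves at most two `±1` spins with nonnegative
couplings, `tanh(h_z) = ∑_{i∈I} c_i σ_{u_i}` with `c_i ≥ 0` (`c3_tanh_linear`:
`tanh(as+bt) = αs + α't` on `{±1}²` with `α = (tanh(a+b)+tanh(a-b))/2 ≥ 0`,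
`α' = (tanh(a+b)-tanh(a-b))/2 ≥ 0`).  Hence `Σ_zq = ∑_i c_i Σ_{u_i q}` for all `q ≠ z`, i.e. the
vector `w = e_z − ∑_i c_i e_{u_i}` satisfies `(wᵀΣ)_q = 0` for `q ≠ z`, so `wᵀΣ = c e_zᵀ` with
`c = (wᵀΣ)_z` and `wᵀ = c (Σ⁻¹)_{z,·}`.  Reading this at `z` gives `c (Σ⁻¹)_zz = w_z = 1`, whence
`c > 0` because `Σ` (hence `Σ⁻¹`) is positive definite (`c3_posDef`, adapted from the sibling file
`…EntryNonposOfPcov.lean`, which is not yet importable on the farm); reading it at `y ≠ z` gives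
`(Σ⁻¹)_zy = w_y / c = −(∑_{i : u_i = y} c_i)/c ≤ 0`.  Degenerate cases (`deg z ≤ 1`, both bonds to
the same site) are covered uniformly: `I = ∅` gives `tanh 0 = 0`, `I = {i}` gives `tanh(K_i)σ_{u_i}`.
-/

namespace Summit.CriticalPhenomena.Ising3DConformalLimit.Cruxes.InverseMFerromagnet.PartialCovarianceLadder

open Literature.Probability.LatticeModels Finset Matrix

/-! ## General facts about `gksExpect s K C` (any finite site type) -/

/-- Linearity of `gksExpect` over finite linear combinations (any site type, any family of
couplings). [folklore] -/
theorem c3_gksExpect_sum_mul {Λ ι κ : Type*} [Fintype Λ] [DecidableEq Λ] (s : Finset ι)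
    (K : ι → ℝ) (C : ι → Finset Λ) (t : Finset κ) (c : κ → ℝ) (f : κ → SpinConfig Λ → ℝ) :
    gksExpect s K C (fun ω => ∑ i ∈ t, c i * f i ω) = ∑ i ∈ t, c i * gksExpect s K C (f i) := by
  -- adapted from Theorems/PrecisionLaplacianInverseMFerromagnetLevelTwo.lean (`l2_gksExpect_sum_mul`)
  have h : ∑ ω, (∑ i ∈ t, c i * f i ω) * gksWeight s K C ω
      = ∑ i ∈ t, c i * ∑ ω, f i ω * gksWeight s K C ω := by
    simp_rw [Finset.sum_mul, Finset.mul_sum, mul_assoc]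
    exact Finset.sum_comm
  simp only [gksExpect, gksSum, h, Finset.sum_div, mul_div_assoc]

/-- **The second-moment matrix `Σ = (⟨σ_pσ_q⟩)` is positive definite**, for any finite site type
and any family of real couplings: `vᵀΣv = ⟨(∑ v_pσ_p)²⟩ > 0` for `v ≠ 0`, testing on the
configuration `σ_p = sign v_p` (every configuration has positive weight). [folklore] -/
theorem c3_posDef {Λ ι : Type*} [Fintype Λ] [DecidableEq Λ] (s : Finset ι) (K : ι → ℝ)
    (C : ι → Finset Λ) :
    (Matrix.of fun p q : Λ => gksExpect s K C (fun ω => spinAt p ω * spinAt q ω)).PosDef := by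
  -- adapted from Theorems/PrecisionLaplacianInverseMFerromagnetEntryNonposOfPcov.lean (`schur_posDef`)
  rw [Matrix.posDef_iff_dotProduct_mulVec]
  refine ⟨?_, fun v hv => ?_⟩
  · refine Matrix.IsHermitian.ext fun p q => ?_
    simp only [Matrix.of_apply, star_trivial]
    exact congrArg _ (funext fun ω => mul_comm _ _)
  · simp only [star_trivial]
    have hq : dotProduct v
        ((Matrix.of fun p q : Λ => gksExpect s K C (fun ω => spinAt p ω * spinAt q ω)).mulVec v)
        = gksExpect s K C (fun ω => (∑ p, v p * spinAt p ω) ^ 2) := by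
      have hsq : (fun ω : SpinConfig Λ => (∑ p, v p * spinAt p ω) ^ 2)
          = fun ω => ∑ p, v p * ∑ q, v q * (spinAt p ω * spinAt q ω) := by
        funext ω
        rw [sq, Finset.sum_mul_sum]
        refine Finset.sum_congr rfl fun p _ => ?_
        rw [Finset.mul_sum]
        exact Finset.sum_congr rfl fun q _ => by ring
      rw [hsq, c3_gksExpect_sum_mul]
      simp only [dotProduct, Matrix.mulVec, Matrix.of_apply]
      refine Finset.sum_congr rfl fun p _ => ?_
      rw [c3_gksExpect_sum_mul]
      congr 1
      exact Finset.sum_congr rfl fun q _ => mul_comm _ _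
    rw [hq]
    -- test configuration `σ_p = sign v_p`
    let ω₀ : SpinConfig Λ := fun p => if 0 ≤ v p then 1 else -1
    have hterm : ∀ p, v p * spinAt p ω₀ = |v p| := by
      intro p
      by_cases hp : 0 ≤ v p
      · simp [ω₀, spinAt, hp, abs_of_nonneg hp]
      · simp [ω₀, spinAt, hp, abs_of_neg (lt_of_not_ge hp)]
    obtain ⟨p, hp⟩ : ∃ p, v p ≠ 0 := by
      by_contra hall
      push Not at hall
      exact hv (funext hall)
    have h0 : 0 < (∑ q, v q * spinAt q ω₀) ^ 2 := by
      simp_rw [hterm]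
      have : 0 < ∑ q, |v q| :=
        Finset.sum_pos' (fun q _ => abs_nonneg _) ⟨p, Finset.mem_univ _, abs_pos.mpr hp⟩
      positivity
    -- every configuration has positive weight
    unfold gksExpect
    refine div_pos ?_ (gksSum_one_pos s K C)
    unfold gksSum
    apply Finset.sum_pos'
    · intro ω _; exact mul_nonneg (sq_nonneg _) (gksWeight_pos s K C ω).le
    · exact ⟨ω₀, Finset.mem_univ _, mul_pos h0 (gksWeight_pos s K C ω₀)⟩

/-! ## The flip at a site `z` -/

/-- Reindexing a sum over configurations by the (involutive) flip at `z`. [folklore] -/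
theorem c3_sum_flip {n : ℕ} (z : Fin n) (φ : SpinConfig (Fin n) → SpinConfig (Fin n))
    (hφ : ∀ ω p, φ ω p = if p = z then -ω p else ω p) (g : SpinConfig (Fin n) → ℝ) :
    ∑ ω, g (φ ω) = ∑ ω, g ω := by
  have hinv : Function.Involutive φ := by
    intro ω
    funext p
    rw [hφ, hφ]
    by_cases hp : p = z <;> simp [hp]
  exact Equiv.sum_comp hinv.toPerm g

/-- Spins under the flip at `z`: `σ_z ↦ -σ_z`, the others are unchanged. [folklore] -/
theorem c3_spinAt_flip {n : ℕ} (z : Fin n) (φ : SpinConfig (Fin n) → SpinConfig (Fin n))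
    (hφ : ∀ ω p, φ ω p = if p = z then -ω p else ω p) (p : Fin n) (ω : SpinConfig (Fin n)) :
    spinAt p (φ ω) = if p = z then -spinAt p ω else spinAt p ω := by
  unfold spinAt
  rw [hφ]
  split_ifs <;> simp [Units.val_neg]

/-- A spin product avoiding `z` is invariant under the flip at `z`. [folklore] -/
theorem c3_spinProduct_flip_of_not_mem {n : ℕ} (z : Fin n)
    (φ : SpinConfig (Fin n) → SpinConfig (Fin n))
    (hφ : ∀ ω p, φ ω p = if p = z then -ω p else ω p) (A : Finset (Fin n)) (hz : z ∉ A)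
    (ω : SpinConfig (Fin n)) : spinProduct A (φ ω) = spinProduct A ω := by
  unfold spinProduct
  refine Finset.prod_congr rfl fun p hp => ?_
  rw [c3_spinAt_flip z φ hφ, if_neg (fun h : p = z => hz (h ▸ hp))]

/-- The pair Hamiltonian under the flip at `z`: `H(φω) = H(ω) − 2 σ_z h_z(ω)` with the local field
`h_z = ∑_{i : z ∈ C i} K_i σ_{u_i}`, `C i = {z, u_i}`. [folklore] -/
theorem c3_hamiltonian_flip {n m : ℕ} (K : Fin m → ℝ) (C : Fin m → Finset (Fin n)) (z : Fin n)
    (φ : SpinConfig (Fin n) → SpinConfig (Fin n))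
    (hφ : ∀ ω p, φ ω p = if p = z then -ω p else ω p) (I : Finset (Fin m))
    (hI : ∀ i, i ∈ I ↔ z ∈ C i) (u : Fin m → Fin n) (hu : ∀ i, z ∈ C i → C i = {z, u i})
    (huz : ∀ i, u i ≠ z) (ω : SpinConfig (Fin n)) :
    gksHamiltonian Finset.univ K C (φ ω)
      = gksHamiltonian Finset.univ K C ω - 2 * spinAt z ω * ∑ i ∈ I, K i * spinAt (u i) ω := by
  have hsum : ∑ i ∈ I, K i * spinAt (u i) ω
      = ∑ i, if z ∈ C i then K i * spinAt (u i) ω else 0 := by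
    rw [← Finset.sum_filter]
    congr 1
    ext i
    simp [hI]
  rw [hsum]
  unfold gksHamiltonian
  rw [Finset.mul_sum, ← Finset.sum_sub_distrib]
  refine Finset.sum_congr rfl fun i _ => ?_
  by_cases hzi : z ∈ C i
  · rw [if_pos hzi, hu i hzi]
    unfold spinProduct
    rw [Finset.prod_pair (huz i).symm, Finset.prod_pair (huz i).symm,
      c3_spinAt_flip z φ hφ z, if_pos rfl, c3_spinAt_flip z φ hφ (u i), if_neg (huz i)]
    ring
  · rw [if_neg hzi, c3_spinProduct_flip_of_not_mem z φ hφ (C i) hzi]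
    ring

/-- The scalar identity behind "integrating out one `±1` spin": for `σ = ±1`,
`σ (1 − e^{−2σx}) = tanh x · (1 + e^{−2σx})`. [folklore] -/
theorem c3_tanh_scalar (x σ : ℝ) (hσ : σ = 1 ∨ σ = -1) :
    σ * (1 - Real.exp (-(2 * σ * x))) = Real.tanh x * (1 + Real.exp (-(2 * σ * x))) := by
  have h1 : Real.exp x * Real.exp (-x) = 1 := by
    rw [← Real.exp_add, add_neg_cancel, Real.exp_zero]
  have hpos : 0 < Real.exp x + Real.exp (-x) := by positivity
  rw [Real.tanh_eq, div_mul_eq_mul_div, eq_div_iff hpos.ne']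
  rcases hσ with rfl | rfl
  · rw [show -(2 * (1 : ℝ) * x) = -x + -x by ring, Real.exp_add]
    linear_combination (-2 * Real.exp (-x)) * h1
  · rw [show -(2 * (-1 : ℝ) * x) = x + x by ring, Real.exp_add]
    linear_combination (2 * Real.exp x) * h1

/-- **Integrating out `σ_z`.**  For every observable `F` invariant under the flip at `z`,
`⟨σ_z F⟩ = ⟨tanh(h_z) F⟩` with `h_z = ∑_{i : z ∈ C i} K_i σ_{u_i}` (pair the configurations `ω`
and `φω`: `W(φω) = W(ω) e^{−2σ_z h_z}`). [folklore] -/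
theorem c3_gksExpect_spin_eq_tanh {n m : ℕ} (K : Fin m → ℝ) (C : Fin m → Finset (Fin n))
    (z : Fin n) (φ : SpinConfig (Fin n) → SpinConfig (Fin n))
    (hφ : ∀ ω p, φ ω p = if p = z then -ω p else ω p) (I : Finset (Fin m))
    (hI : ∀ i, i ∈ I ↔ z ∈ C i) (u : Fin m → Fin n) (hu : ∀ i, z ∈ C i → C i = {z, u i})
    (huz : ∀ i, u i ≠ z) (F : SpinConfig (Fin n) → ℝ) (hF : ∀ ω, F (φ ω) = F ω) :
    gksExpect Finset.univ K C (fun ω => spinAt z ω * F ω)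
      = gksExpect Finset.univ K C
          (fun ω => Real.tanh (∑ i ∈ I, K i * spinAt (u i) ω) * F ω) := by
  simp only [gksExpect, gksSum]
  congr 1
  obtain ⟨W, hW⟩ : ∃ W : SpinConfig (Fin n) → ℝ, ∀ ω, W ω = gksWeight Finset.univ K C ω :=
    ⟨_, fun _ => rfl⟩
  obtain ⟨hz, hhz⟩ : ∃ hz : SpinConfig (Fin n) → ℝ, ∀ ω, hz ω = ∑ i ∈ I, K i * spinAt (u i) ω :=
    ⟨_, fun _ => rfl⟩
  simp only [← hW, ← hhz]
  have hσ : ∀ ω, spinAt z (φ ω) = -spinAt z ω := fun ω => by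
    rw [c3_spinAt_flip z φ hφ, if_pos rfl]
  have hh : ∀ ω, hz (φ ω) = hz ω := fun ω => by
    rw [hhz, hhz]
    exact Finset.sum_congr rfl fun i _ => by rw [c3_spinAt_flip z φ hφ, if_neg (huz i)]
  have hWφ : ∀ ω, W (φ ω) = W ω * Real.exp (-(2 * spinAt z ω * hz ω)) := fun ω => by
    rw [hW, hW, hhz]
    unfold gksWeight
    rw [c3_hamiltonian_flip K C z φ hφ I hI u hu huz ω, sub_eq_add_neg, Real.exp_add]
  obtain ⟨a, ha⟩ : ∃ a : SpinConfig (Fin n) → ℝ, ∀ ω, a ω = spinAt z ω * F ω * W ω :=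
    ⟨_, fun _ => rfl⟩
  obtain ⟨b, hb⟩ : ∃ b : SpinConfig (Fin n) → ℝ, ∀ ω, b ω = Real.tanh (hz ω) * F ω * W ω :=
    ⟨_, fun _ => rfl⟩
  have key : ∀ ω, a ω + a (φ ω) = b ω + b (φ ω) := fun ω => by
    rw [ha, ha, hb, hb, hσ, hF, hh, hWφ]
    have e := c3_tanh_scalar (hz ω) (spinAt z ω) (spinAt_eq_one_or_eq_neg_one z ω)
    calc spinAt z ω * F ω * W ω
          + -spinAt z ω * F ω * (W ω * Real.exp (-(2 * spinAt z ω * hz ω)))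
        = F ω * W ω * (spinAt z ω * (1 - Real.exp (-(2 * spinAt z ω * hz ω)))) := by ring
      _ = F ω * W ω * (Real.tanh (hz ω) * (1 + Real.exp (-(2 * spinAt z ω * hz ω)))) := by
          rw [e]
      _ = _ := by ring
  have h2 : ∑ ω, a ω + ∑ ω, a ω = ∑ ω, b ω + ∑ ω, b ω := by
    calc ∑ ω, a ω + ∑ ω, a ω = ∑ ω, a ω + ∑ ω, a (φ ω) := by rw [c3_sum_flip z φ hφ a]
      _ = ∑ ω, (a ω + a (φ ω)) := Finset.sum_add_distrib.symm
      _ = ∑ ω, (b ω + b (φ ω)) := Finset.sum_congr rfl fun ω _ => key ω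
      _ = ∑ ω, b ω + ∑ ω, b (φ ω) := Finset.sum_add_distrib
      _ = ∑ ω, b ω + ∑ ω, b ω := by rw [c3_sum_flip z φ hφ b]
  calc ∑ ω, spinAt z ω * F ω * W ω = ∑ ω, a ω := Finset.sum_congr rfl fun ω _ => (ha ω).symm
    _ = ∑ ω, b ω := by linarith
    _ = _ := Finset.sum_congr rfl fun ω _ => hb ω

/-! ## `tanh` of a nonnegative combination of at most two `±1` spins is linear, coefficients `≥ 0` -/

/-- For `|I| ≤ 2`, `K ≥ 0`: there are `c_i ≥ 0` with `tanh(∑_{i∈I} K_i p_i) = ∑_{i∈I} c_i p_i` for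
all `p ∈ {±1}^I` (for `I = {a,b}`: `c_a = (tanh(K_a+K_b) + tanh(K_a−K_b))/2 =
sinh(2K_a)/(2cosh(K_a+K_b)cosh(K_a−K_b)) ≥ 0`, similarly `c_b`). [folklore] -/
theorem c3_tanh_linear {ι : Type*} [DecidableEq ι] (I : Finset ι) (hI : I.card ≤ 2) (K : ι → ℝ)
    (hK : ∀ i, 0 ≤ K i) :
    ∃ c : ι → ℝ, (∀ i, 0 ≤ c i) ∧ ∀ p : ι → ℝ, (∀ i, p i = 1 ∨ p i = -1) →
      Real.tanh (∑ i ∈ I, K i * p i) = ∑ i ∈ I, c i * p i := by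
  have htanh_nonneg : ∀ x : ℝ, 0 ≤ x → 0 ≤ Real.tanh x := fun x hx => by
    rw [Real.tanh_eq_sinh_div_cosh]
    exact div_nonneg (Real.sinh_nonneg_iff.2 hx) (Real.cosh_pos x).le
  obtain h | h | h : I.card = 0 ∨ I.card = 1 ∨ I.card = 2 := by omega
  · rw [Finset.card_eq_zero] at h
    subst h
    exact ⟨fun _ => 0, fun _ => le_rfl, fun p _ => by simp⟩
  · obtain ⟨a, rfl⟩ := Finset.card_eq_one.1 h
    refine ⟨fun _ => Real.tanh (K a), fun _ => htanh_nonneg _ (hK a), fun p hp => ?_⟩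
    simp only [Finset.sum_singleton]
    rcases hp a with h1 | h1 <;> rw [h1]
    · rw [mul_one, mul_one]
    · rw [mul_neg_one, mul_neg_one, Real.tanh_neg]
  · obtain ⟨a, b, hab, rfl⟩ := Finset.card_eq_two.1 h
    have hcc : 0 < Real.cosh (K a + K b) * Real.cosh (K a - K b) :=
      mul_pos (Real.cosh_pos _) (Real.cosh_pos _)
    have hA : 0 ≤ Real.tanh (K a + K b) + Real.tanh (K a - K b) := by
      rw [Real.tanh_eq_sinh_div_cosh, Real.tanh_eq_sinh_div_cosh,
        div_add_div _ _ (Real.cosh_pos _).ne' (Real.cosh_pos _).ne', ← Real.sinh_add]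
      exact div_nonneg (Real.sinh_nonneg_iff.2 (by linarith [hK a])) hcc.le
    have hB : 0 ≤ Real.tanh (K a + K b) - Real.tanh (K a - K b) := by
      rw [Real.tanh_eq_sinh_div_cosh, Real.tanh_eq_sinh_div_cosh,
        div_sub_div _ _ (Real.cosh_pos _).ne' (Real.cosh_pos _).ne', ← Real.sinh_sub]
      exact div_nonneg (Real.sinh_nonneg_iff.2 (by linarith [hK b])) hcc.le
    refine ⟨fun i => if i = a then (Real.tanh (K a + K b) + Real.tanh (K a - K b)) / 2
        else (Real.tanh (K a + K b) - Real.tanh (K a - K b)) / 2, fun i => ?_, fun p hp => ?_⟩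
    · dsimp only
      by_cases hi : i = a
      · rw [if_pos hi]; linarith
      · rw [if_neg hi]; linarith
    · dsimp only
      rw [Finset.sum_pair hab, Finset.sum_pair hab, if_pos rfl, if_neg (Ne.symm hab)]
      rcases hp a with h1 | h1 <;> rcases hp b with h2 | h2 <;> rw [h1, h2]
      · rw [show K a * 1 + K b * 1 = K a + K b by ring]
        ring
      · rw [show K a * 1 + K b * -1 = K a - K b by ring]
        ring
      · rw [show K a * -1 + K b * 1 = -(K a - K b) by ring, Real.tanh_neg]
        ring
      · rw [show K a * -1 + K b * -1 = -(K a + K b) by ring, Real.tanh_neg]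
        ring

/-! ## The registered stub -/

/-- Registered stub `stub_row_deg_le_two` (C3 of line `Sketch`): for the spin second-moment matrix
`Σ = (⟨σ_pσ_q⟩)` of a zero-field pair ferromagnet (`K ≥ 0`, `|C i| = 2`), if the site `z` lies in
at most two bonds then `(Σ⁻¹)_zy ≤ 0` for every `y ≠ z`.  `E[σ_z | rest] = tanh(h_z)` is an odd,
hence linear, function of at most two spins with nonnegative coefficients `c_i`, so
`Σ_zq = ∑_i c_i Σ_{u_i q}` (`q ≠ z`) and row `z` of `Σ⁻¹` is a positive multiple of
`e_z − ∑_i c_i e_{u_i}`. [folklore] -/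
theorem stub_row_deg_le_two : ∀ (n m : ℕ) (K : Fin m → ℝ) (C : Fin m → Finset (Fin n)), (∀ i, 0 ≤ K i) → (∀ i, (C i).card = 2) → ∀ z y : Fin n, z ≠ y → (Finset.univ.filter (fun i => z ∈ C i)).card ≤ 2 → (Matrix.of fun p q : Fin n => gksExpect Finset.univ K C (fun ω => spinAt p ω * spinAt q ω))⁻¹ z y ≤ 0 := by
  intro n m K C hK hC z y hzy hdeg
  -- the partner `u i` of `z` in each bond `C i ∋ z`
  have hex : ∀ i : Fin m, ∃ a : Fin n, a ≠ z ∧ (z ∈ C i → C i = {z, a}) := by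
    intro i
    by_cases hz : z ∈ C i
    · have h1 : ((C i).erase z).card = 1 := by rw [Finset.card_erase_of_mem hz, hC i]
      obtain ⟨a, ha⟩ := Finset.card_eq_one.1 h1
      have haz : a ∈ (C i).erase z := by rw [ha]; exact Finset.mem_singleton_self a
      exact ⟨a, (Finset.mem_erase.1 haz).1, fun _ => by rw [← Finset.insert_erase hz, ha]⟩
    · exact ⟨y, hzy.symm, fun h => absurd h hz⟩
  choose u huz hu using hex
  set I : Finset (Fin m) := Finset.univ.filter (fun i => z ∈ C i) with hIdef
  have hI : ∀ i, i ∈ I ↔ z ∈ C i := fun i => by simp [hIdef]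
  obtain ⟨φ, hφ⟩ : ∃ φ : SpinConfig (Fin n) → SpinConfig (Fin n),
      ∀ ω p, φ ω p = if p = z then -ω p else ω p :=
    ⟨fun ω p => if p = z then -ω p else ω p, fun _ _ => rfl⟩
  obtain ⟨c, hc0, hc⟩ := c3_tanh_linear I hdeg K hK
  have hT : ∀ ω : SpinConfig (Fin n),
      Real.tanh (∑ i ∈ I, K i * spinAt (u i) ω) = ∑ i ∈ I, c i * spinAt (u i) ω :=
    fun ω => hc (fun i => spinAt (u i) ω) (fun i => spinAt_eq_one_or_eq_neg_one (u i) ω)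
  set A : Matrix (Fin n) (Fin n) ℝ :=
    Matrix.of (fun p q : Fin n => gksExpect Finset.univ K C (fun ω => spinAt p ω * spinAt q ω))
    with hA
  -- `Σ_zq = ∑_i c_i Σ_{u_i q}` for `q ≠ z`
  have hkey : ∀ q, q ≠ z → A z q = ∑ i ∈ I, c i * A (u i) q := by
    intro q hq
    have h1 := c3_gksExpect_spin_eq_tanh K C z φ hφ I hI u hu huz (spinAt q)
      (fun ω => by rw [c3_spinAt_flip z φ hφ, if_neg hq])
    have h2 : (fun ω => Real.tanh (∑ i ∈ I, K i * spinAt (u i) ω) * spinAt q ω)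
        = fun ω => ∑ i ∈ I, c i * (spinAt (u i) ω * spinAt q ω) := by
      funext ω
      rw [hT ω, Finset.sum_mul]
      exact Finset.sum_congr rfl fun i _ => by ring
    rw [h2, c3_gksExpect_sum_mul] at h1
    simpa only [hA, Matrix.of_apply] using h1
  -- linear algebra on the positive definite matrix `A`
  have hPD : A.PosDef := c3_posDef Finset.univ K C
  have hdet : IsUnit A.det := (Matrix.isUnit_iff_isUnit_det A).mp hPD.isUnit
  obtain ⟨w, hw⟩ : ∃ w : Fin n → ℝ,
      ∀ p, w p = (if p = z then (1 : ℝ) else 0) - ∑ i ∈ I, (if u i = p then c i else 0) :=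
    ⟨_, fun _ => rfl⟩
  have hwsum : ∀ f : Fin n → ℝ, ∑ p, w p * f p = f z - ∑ i ∈ I, c i * f (u i) := by
    intro f
    have h1 : ∀ p, w p * f p
        = (if p = z then f p else 0) - ∑ i ∈ I, (if u i = p then c i * f p else 0) := by
      intro p
      rw [hw, sub_mul, Finset.sum_mul]
      congr 1
      · split_ifs <;> simp
      · exact Finset.sum_congr rfl fun i _ => by split_ifs <;> simp
    simp_rw [h1]
    rw [Finset.sum_sub_distrib, Finset.sum_ite_eq', Finset.sum_comm]
    simp [Finset.sum_ite_eq]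
  have hwA : ∀ q, q ≠ z → (w ᵥ* A) q = 0 := by
    intro q hq
    simp only [Matrix.vecMul, dotProduct]
    rw [hwsum (fun p => A p q), hkey q hq, sub_self]
  obtain ⟨cz, hcz⟩ : ∃ cz : ℝ, cz = (w ᵥ* A) z := ⟨_, rfl⟩
  have hvec : w ᵥ* A = Pi.single z cz := by
    funext q
    by_cases hq : q = z
    · rw [hq, Pi.single_eq_same, hcz]
    · rw [Pi.single_eq_of_ne hq, hwA q hq]
  have hwq : ∀ q, w q = cz * A⁻¹ z q := by
    have h : w = cz • A⁻¹ z := by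
      calc w = (w ᵥ* A) ᵥ* A⁻¹ := by
            rw [Matrix.vecMul_vecMul, Matrix.mul_nonsing_inv A hdet, Matrix.vecMul_one]
        _ = cz • A⁻¹ z := by rw [hvec, Matrix.single_vecMul]; rfl
    intro q
    have hq' := congrFun h q
    simpa only [Pi.smul_apply, smul_eq_mul] using hq'
  have hwz : w z = 1 := by
    rw [hw, if_pos rfl]
    simp [huz]
  have hwy : w y ≤ 0 := by
    rw [hw, if_neg (Ne.symm hzy), zero_sub, neg_nonpos]
    exact Finset.sum_nonneg fun i _ => by
      split_ifs
      · exact hc0 i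
      · exact le_rfl
  have hcz_pos : 0 < cz := by
    have h1 : 0 < cz * A⁻¹ z z := by rw [← hwq z, hwz]; exact one_pos
    exact pos_of_mul_pos_left h1 hPD.inv.diag_pos.le
  have hy := hwq y
  rcases lt_or_ge 0 (A⁻¹ z y) with hpos | hle
  · exact absurd (hy ▸ hwy) (not_le.2 (mul_pos hcz_pos hpos))
  · exact hle

end Summit.CriticalPhenomena.Ising3DConformalLimit.Cruxes.InverseMFerromagnet.PartialCovarianceLadder
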